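import Summits.QuantumFields.BalabanUV.Beta.GAN24.SrecAtSlotRows
import Summits.QuantumFields.BalabanUV.Beta.GAN24.BornBorderDrift
import Summits.QuantumFields.BalabanUV.Beta.GAN24.BornBorderDriftAssembly
import Summits.QuantumFields.BalabanUV.Beta.GAN24.BornBorderContactPairBound
import Summits.QuantumFields.BalabanUV.Beta.GAN24.BornLambdaDriftAssembly
import Summits.QuantumFields.BalabanUV.Beta.GAN24.BornLambdaContactDrift

/-!
# `BalabanUV.Beta.GAN24.SrecAtSlotRowsFinal` — binder row G-an2-4 / (CONV-C), CT-ROUTE: **THE S-SLOT ROWS `(hS, hSall)` OF THE RECURSIVE COMB FAMILY (E) = `SrecAt`,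
# UNCONDITIONALLY** (`d = 3`, every `Lc ≥ 2`, pin `cE = Lc^4`, every `cVH cΛ`, every in-block root; and at the centre root with the D1 pins `cVH = −Lc^8∕2`):
# the owner's socket `SrecAtSlotRows.exists_hS_hSall_SrecAt_three_of_born` (hS0 ✓ + hSdev(E-Wilson) ✓ inside) with the born sectors' rate letter DISCHARGED by the
# crux team's ENDs plugged BY NAME — leaf-04 g57's junction `BornBorderDrift.exists_hBdev_of_sectors` over leaf-04's `BornBorderDriftAssembly.exists_hBdevV_three_of_contactPairs`
# (⟸ leaf-03 g56's (V-C)-DIFF `BornBorderContactPairBound.exists_hPcV_three`) and leaf-06 g41's `BornLambdaDriftAssembly.exists_hBdevLam_three_of_contactPairs`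
# (⟸ leaf-01 g61's (C4)-DIFF `BornLambdaContactDrift.exists_hPc_three`).

NOT IN PRINT; OUR PROOF ATTEMPT (the CT-ROUTE C-R8°, CT-1 → CT-4e + BORNSEC rows + rate halves, ASSEMBLED; THIS file is [folklore] assembly BY NAME, four `exact`s).
HONEST FRAMING (cell contract, verbatim): «discharging `BetaPertH` makes Bałaban's UV stability UNCONDITIONAL — a real constructive-QFT result; it is NOT the continuum
limit and NOT the Clay problem.»  HONEST DEPENDENCY (verbatim): «continuum YM on T⁴ ⇐ BetaPertH ∧ nine spine estimates (0/9 proved); BetaPertH ⇐ (D1) ∧ (D4) ∧ CAP+tail;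
G-an2-4 gates asym, D1 and NE2/3/4.»  No cited fact, no wall binder, no `def`, no `def … : Prop`, 0 sorry.  WHAT THIS IS AND IS NOT: (hS, hSall) — `j`-uniform
localisation AND all-scales Cauchy deviations at SOME ratio `θS < 1`, ONE radius `δS > 0` — of the unit tables of the COMB family `SrecAt` (comb dressing
`coDressKBmAt`, in-block roots), i.e. the S-slot residual of road FP's literal of record `JsRowD1Pin` (`D1BFx.RoadEndRowPinned.exists_allScalesSeq_JsRowD1Pin_of_slots`,
binders `hS hSall hδS hθS0 hθS1`; §2 below is that instance); it is NOT the W-slot rows (`hW`, `hWall` on `unitW … (WrecAt …)` — OPEN, an2's road P4 ∕ CT-W), NOT the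
sym family `JsB12Sym` (CT-5, not on the literal's path), NOT (CONV-C) as typed, NEVER «G-an2-4 closed»; NOT D1 (three more row families + letters), NOT `BetaPertH`,
NOT continuum, NOT Clay.
Unit `b2b-balaban-gan24-p1` (row owner G-an2-4, gen 22), 2026-08-21.
-/

noncomputable section

open Literature.MathematicalPhysics.QuantumFieldTheory.Balaban1983to89.Beta
open OneStepResolventKernel (LocStencil)
open AffineAveraging (box toSite)
open AveragingContoursRooted (ctrOff)
open Summit.QuantumFields.BalabanUV.Beta.HessKerDressedUnits (unitS)
open Summit.QuantumFields.BalabanUV.Beta.GAN24.CombesThomas (sfStep smStep)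
open Summit.QuantumFields.BalabanUV.Beta.WardLocusRecursive (SrecAt)
open Summit.QuantumFields.BalabanUV.Beta.GAN24.SrecWilsonSector (bornSecAt)
open Summit.QuantumFields.BalabanUV.Beta.GAN24.SrecAtRowHoldsFinal (abs_cE_le)
open Summit.QuantumFields.BalabanUV.Beta.GAN24.SrecAtSlotRows (exists_hSall_SrecAt_three_of_born exists_hS_hSall_SrecAt_three_of_born exists_hS_hSall_SrecAt_ctr_of_born)
open Summit.QuantumFields.BalabanUV.Beta.GAN24.BornBorderDrift (exists_hBdev_of_sectors)
open Summit.QuantumFields.BalabanUV.Beta.GAN24.BornBorderDriftAssembly (exists_hBdevV_three_of_contactPairs)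
open Summit.QuantumFields.BalabanUV.Beta.GAN24.BornBorderContactPairBound (exists_hPcV_three)
open Summit.QuantumFields.BalabanUV.Beta.GAN24.BornLambdaDriftAssembly (exists_hBdevLam_three_of_contactPairs)
open Summit.QuantumFields.BalabanUV.Beta.GAN24.BornLambdaContactDrift (exists_hPc_three)

namespace Summit.QuantumFields.BalabanUV.Beta.GAN24.SrecAtSlotRowsFinal

variable {Lc : ℕ} [NeZero Lc]

/-! ## §1 Every in-block root, every `cVH cΛ` -/

/-- NOT IN PRINT; OUR PROOF ATTEMPT ([folklore] assembly BY NAME; UNCONDITIONAL).  **hBdev OF THE `d = 3` COMB FAMILY'S BORN REMAINDER** (`Lc ≥ 2`, pin `cE = Lc^4`,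
every `cVH cΛ`): leaf-04 g57's junction over the V half (leaf-04's assembly ∘ leaf-03 g56's contact pair letter) and the Λ half (leaf-06 g41's assembly ∘ leaf-01 g61's
contact pair letter), both at the polynomial weight `q = 1`. -/
theorem exists_hBdev_three (hLc : 2 ≤ Lc) {cE : ℝ} (hcE : cE = (Lc : ℝ) ^ (3 + 1)) (cVH cΛ : ℝ) :
    ∃ cB θB δB : ℝ, 0 ≤ cB ∧ 0 ≤ θB ∧ θB < 1 ∧ 0 < δB ∧ ∀ (rr : Fin (3 + 1) → ℕ), rr ∈ box (3 + 1) Lc → ∀ k j : ℕ,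
      LocStencil (unitS (sfStep Lc (k + j)) (smStep 3 Lc (k + j)) (bornSecAt Lc (toSite rr) cE cVH cΛ (k + j))
        - unitS (sfStep Lc k) (smStep 3 Lc k) (bornSecAt Lc (toSite rr) cE cVH cΛ k)) (cB * θB ^ k) δB :=
  exists_hBdev_of_sectors (d := 3) cE cVH cΛ
    (exists_hBdevV_three_of_contactPairs hLc hcE cVH 1 (exists_hPcV_three hLc hcE cVH))
    (exists_hBdevLam_three_of_contactPairs hLc hcE cΛ 1 (exists_hPc_three hLc (abs_cE_le hcE) cΛ))

/-- NOT IN PRINT; OUR PROOF ATTEMPT ([folklore] assembly; UNCONDITIONAL).  **(hSall) OF THE `d = 3` COMB FAMILY (E) = `SrecAt`**: `∃ cS θS δS, 0 ≤ cS ∧ 0 ≤ θS ∧ θS < 1 ∧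
0 < δS ∧` for every in-block root `rr` and all `k j`, `LocStencil (unitS_{k+j}(SrecAt … (k+j)) − unitS_k(SrecAt … k)) (cS·θS^k) δS`. -/
theorem exists_hSall_SrecAt_three (hLc : 2 ≤ Lc) {cE : ℝ} (hcE : cE = (Lc : ℝ) ^ (3 + 1)) (cVH cΛ : ℝ) :
    ∃ cS θS δS : ℝ, 0 ≤ cS ∧ 0 ≤ θS ∧ θS < 1 ∧ 0 < δS ∧ ∀ (rr : Fin (3 + 1) → ℕ), rr ∈ box (3 + 1) Lc → ∀ k j : ℕ,
      LocStencil (unitS (sfStep Lc (k + j)) (smStep 3 Lc (k + j)) (SrecAt 3 Lc (toSite rr) cE cVH cΛ (k + j))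
        - unitS (sfStep Lc k) (smStep 3 Lc k) (SrecAt 3 Lc (toSite rr) cE cVH cΛ k)) (cS * θS ^ k) δS :=
  exists_hSall_SrecAt_three_of_born hLc hcE cVH cΛ (exists_hBdev_three hLc hcE cVH cΛ)

/-- NOT IN PRINT; OUR PROOF ATTEMPT ([folklore] assembly; UNCONDITIONAL).  **THE S-SLOT ROWS `(hS, hSall)` OF THE `d = 3` COMB FAMILY AT ONE COMMON RATE**
(`Lc ≥ 2`, pin `cE = Lc^4`, every `cVH cΛ`, every in-block root). -/
theorem exists_hS_hSall_SrecAt_three (hLc : 2 ≤ Lc) {cE : ℝ} (hcE : cE = (Lc : ℝ) ^ (3 + 1)) (cVH cΛ : ℝ) :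
    ∃ Cs cS θS δS : ℝ, 0 ≤ θS ∧ θS < 1 ∧ 0 < δS ∧ ∀ (rr : Fin (3 + 1) → ℕ), rr ∈ box (3 + 1) Lc →
      (∀ j : ℕ, LocStencil (unitS (sfStep Lc j) (smStep 3 Lc j) (SrecAt 3 Lc (toSite rr) cE cVH cΛ j)) Cs δS) ∧
      (∀ k j : ℕ, LocStencil (unitS (sfStep Lc (k + j)) (smStep 3 Lc (k + j)) (SrecAt 3 Lc (toSite rr) cE cVH cΛ (k + j))
        - unitS (sfStep Lc k) (smStep 3 Lc k) (SrecAt 3 Lc (toSite rr) cE cVH cΛ k)) (cS * θS ^ k) δS) :=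
  exists_hS_hSall_SrecAt_three_of_born hLc hcE cVH cΛ (exists_hBdev_three hLc hcE cVH cΛ)

/-! ## §2 The centre root and the D1 pins -/

/-- NOT IN PRINT; OUR PROOF ATTEMPT ([folklore] assembly; UNCONDITIONAL).  **THE S-SLOT ROWS OF ROAD FP's LITERAL OF RECORD** (`Lc ≥ 2`, `ρ_c = toSite (ctrOff (3+1) Lc)`,
`cE := Lc^4`, `cVH := −Lc^8∕2`, any `cΛ`): `∃ Cs cS θS δS, 0 ≤ θS ∧ θS < 1 ∧ 0 < δS ∧ (∀ j, LocStencil (unitS_j (SrecAt 3 Lc ρ_c Lc⁴ (−Lc⁸∕2) cΛ j)) Cs δS) ∧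
(∀ k j, LocStencil (… (k+j) − … k) (cS·θS^k) δS)` — the binders `hS hSall hδS hθS0 hθS1` of `D1BFx.RoadEndRowPinned.exists_allScalesSeq_JsRowD1Pin_of_slots` (at
`cΛ := 2∕Lc^4`) ∕ of `FP.RoadRowD1Slots.d1Drift_JsRowD1_of_slots_wardLetters_explicitDefect` (any `cΛ`), for the COMB family.  The W-slot rows stay hypotheses there. -/
theorem exists_hS_hSall_SrecAt_ctr (hLc : 2 ≤ Lc) (cΛ : ℝ) :
    ∃ Cs cS θS δS : ℝ, 0 ≤ θS ∧ θS < 1 ∧ 0 < δS ∧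
      (∀ j : ℕ, LocStencil (unitS (sfStep Lc j) (smStep 3 Lc j)
        (SrecAt 3 Lc (toSite (ctrOff (3 + 1) Lc)) ((Lc : ℝ) ^ 4) (-((Lc : ℝ) ^ 8 / 2)) cΛ j)) Cs δS) ∧
      (∀ k j : ℕ, LocStencil (unitS (sfStep Lc (k + j)) (smStep 3 Lc (k + j))
          (SrecAt 3 Lc (toSite (ctrOff (3 + 1) Lc)) ((Lc : ℝ) ^ 4) (-((Lc : ℝ) ^ 8 / 2)) cΛ (k + j))
        - unitS (sfStep Lc k) (smStep 3 Lc k)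
          (SrecAt 3 Lc (toSite (ctrOff (3 + 1) Lc)) ((Lc : ℝ) ^ 4) (-((Lc : ℝ) ^ 8 / 2)) cΛ k)) (cS * θS ^ k) δS) :=
  exists_hS_hSall_SrecAt_ctr_of_born hLc cΛ (exists_hBdev_three hLc (cE := (Lc : ℝ) ^ 4) rfl (-((Lc : ℝ) ^ 8 / 2)) cΛ)

end Summit.QuantumFields.BalabanUV.Beta.GAN24.SrecAtSlotRowsFinal

end
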